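import Literature.NumberTheory.LFunctions.Zhang2022.Section3SigmaSplitting
import Mathlib.Algebra.Order.Chebyshev
import Mathlib.Analysis.SpecialFunctions.Pow.Real

/-!
# Route `GreenTaoLevelTwo`, crux `MNTwo` (stmt-Parity-21276), line `birth`, stub `stub_mnVertical`:
# the divisor packing lemma (GT 2008b App. B, Lemmas 48–49)

Tool for block V5 / H5 (= AIF §11, Proposition 25) of the `stub_mnVertical` census (B. Green,
T. Tao, *Quadratic uniformity of the Möbius function*, Ann. Inst. Fourier 58 (2008) =
arXiv:math/0606087, Appendix B "Divisor moment estimates": Lemma 48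
`𝔼_{n∈[N]} τ(n)^m ≪_m log^{2^m−1} N`, the Hölder consequence (tau-rider)
`𝔼_{n∈A} τ(n)² ≪_κ α^{-κ} log^{2^{2/κ}} N` for `|A| = αN`, and Lemma 49 "Divisor packing lemma":
if `|A_d| ≥ δ|A|` for all `d ∈ 𝔇` (`A_d` = multiples of `d` in `A`) then
`|⋃_{d∈𝔇} A_d| ≫_κ δ²|𝔇|²|A| α^κ log^{-2^{2/κ}} N` — "From hypothesis … `Σ_d |A_d|/|A| ≥ δ|𝔇|`.
By Cauchy–Schwarz … `Σ_{d∈𝔇} 1_{A_d}(n) ≤ τ(n)` and (tau-rider) … the claim follows").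

We take `κ = 1/r` (`r ≥ 1` an integer) and use the tree's divisor power moments
`Zhang2022.sum_card_divisors_pow_div_le_log_pow` (`Σ_{n≤N} τ(n)^j/n ≤ (1+log N)^{2^j}`, any
exponent suffices, as the paper remarks) with Jensen's inequality for `r`-th powers in place of
Hölder; the result is first stated free of real powers, then in the printed shape.  Def-free;
`τ(n) = #n.divisors`.

* `sum_card_divisors_pow_le` — Lemma 48 in the form `Σ_{n≤N} τ(n)^j ≤ N(1+log N)^{2^j}`;
* `sum_card_multiples_eq` — `Σ_{d∈𝔇} |A_d| = Σ_{n∈A} #{d ∈ 𝔇 : d ∣ n}`;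
* `divisor_packing_pow` — **Lemma 49, power form**:
  `(δ|𝔇||A|)^{2r} ≤ |⋃ A_d|^r · |A|^{r−1} · N(1+log N)^{4^r}`;
* `divisor_packing` — **Lemma 49**: `|⋃ A_d| ≥ δ²|𝔇|²|A| · (|A|/(N(1+log N)^{4^r}))^{1/r}`.

References: [GreenTao2008QuadraticMobius] arXiv:math/0606087 App. B, Lemmas 48, 49.
-/

noncomputable section

open Finset Real

namespace Summit.Parity.GeneralizedHardyLittlewood.GreenTaoLevelTwoMNTwoDivisorPacking

open Literature.NumberTheory.LFunctions.Zhang2022 (sum_card_divisors_pow_div_le_log_pow)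

/-- **Lemma 48 (divisor power moments), tree form**: `Σ_{1≤n≤N} τ(n)^j ≤ N (1 + log N)^{2^j}`.
[cite: GreenTao2008QuadraticMobius, App. B, Lemma 48] -/
theorem sum_card_divisors_pow_le (j N : ℕ) :
    ∑ n ∈ Icc 1 N, ((n.divisors.card : ℕ) : ℝ) ^ j ≤ N * (1 + Real.log N) ^ (2 ^ j) := by
  have h := sum_card_divisors_pow_div_le_log_pow j N
  have hN : (0 : ℝ) ≤ N := Nat.cast_nonneg N
  calc ∑ n ∈ Icc 1 N, ((n.divisors.card : ℕ) : ℝ) ^ j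
      ≤ ∑ n ∈ Icc 1 N, (N : ℝ) * (((n.divisors.card : ℕ) : ℝ) ^ j / n) := by
        refine Finset.sum_le_sum fun n hn => ?_
        rw [mem_Icc] at hn
        have hn0 : (0 : ℝ) < n := by exact_mod_cast hn.1
        have hnN : (n : ℝ) ≤ N := by exact_mod_cast hn.2
        rw [mul_div_assoc', le_div_iff₀ hn0]
        exact mul_comm ((N : ℝ)) _ ▸ mul_le_mul_of_nonneg_left hnN (by positivity)
    _ = N * ∑ n ∈ Icc 1 N, ((n.divisors.card : ℕ) : ℝ) ^ j / n := by rw [Finset.mul_sum]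
    _ ≤ N * (1 + Real.log N) ^ (2 ^ j) := mul_le_mul_of_nonneg_left h hN

/-- Double counting: `Σ_{d∈𝔇} |A_d| = Σ_{n∈A} #{d ∈ 𝔇 : d ∣ n}`. [folklore] -/
theorem sum_card_multiples_eq (A 𝔇 : Finset ℕ) :
    ∑ d ∈ 𝔇, #(A.filter fun n => d ∣ n) = ∑ n ∈ A, #(𝔇.filter fun d => d ∣ n) := by
  simp only [Finset.card_filter]
  exact Finset.sum_comm

/-- For `n ≥ 1`, `#{d ∈ 𝔇 : d ∣ n} ≤ τ(n)`. [folklore] -/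
theorem card_filter_dvd_le_card_divisors (𝔇 : Finset ℕ) {n : ℕ} (hn : n ≠ 0) :
    #(𝔇.filter fun d => d ∣ n) ≤ n.divisors.card := by
  classical
  calc #(𝔇.filter fun d => d ∣ n) ≤ #((𝔇.filter fun d => d ∣ n).image id) := by
        rw [Finset.image_id]
    _ ≤ n.divisors.card := by
        rw [Finset.image_id]
        refine Finset.card_le_card fun d hd => ?_
        rw [mem_filter] at hd
        exact Nat.mem_divisors.2 ⟨hd.2, hn⟩

/-- **Lemma 49 (divisor packing), power form.**  Let `A ⊆ {1,…,N}`, `𝔇` a finite set of naturals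
with `|A_d| ≥ δ|A|` for every `d ∈ 𝔇` (`A_d = {n ∈ A : d ∣ n}`, `δ ≥ 0`), and `r ≥ 1`.  Then, with
`U = ⋃_{d∈𝔇} A_d`, `(δ|𝔇||A|)^{2r} ≤ |U|^r · |A|^{r−1} · N (1+log N)^{4^r}`.
[cite: GreenTao2008QuadraticMobius, App. B, Lemma 49] -/
theorem divisor_packing_pow (N : ℕ) (A : Finset ℕ) (hA : A ⊆ Icc 1 N) (𝔇 : Finset ℕ) {δ : ℝ}
    (hδ : 0 ≤ δ) (hAd : ∀ d ∈ 𝔇, δ * #A ≤ #(A.filter fun n => d ∣ n)) {r : ℕ} (hr : 1 ≤ r) :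
    (δ * #𝔇 * #A) ^ (2 * r) ≤
      (#(A.filter fun n => ∃ d ∈ 𝔇, d ∣ n) : ℝ) ^ r * (#A : ℝ) ^ (r - 1) *
        (N * (1 + Real.log N) ^ (4 ^ r)) := by
  classical
  set U : Finset ℕ := A.filter fun n => ∃ d ∈ 𝔇, d ∣ n with hU
  set g : ℕ → ℝ := fun n => (#(𝔇.filter fun d => d ∣ n) : ℝ) with hg
  set τ : ℕ → ℝ := fun n => ((n.divisors.card : ℕ) : ℝ) with hτ
  have hN1 : ∀ n ∈ A, 1 ≤ n ∧ n ≤ N := fun n hn => by simpa using hA hn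
  have hlog : 0 ≤ 1 + Real.log N := by
    rcases Nat.eq_zero_or_pos N with h | h
    · simp [h]
    · have : (1 : ℝ) ≤ N := by exact_mod_cast h
      linarith [Real.log_nonneg this]
  -- `S₁ = Σ_{n∈A} g(n) = Σ_{d} |A_d| ≥ δ |𝔇| |A|`
  have hS₁ : δ * #𝔇 * #A ≤ ∑ n ∈ A, g n := by
    have h1 : ∑ d ∈ 𝔇, δ * #A ≤ ∑ d ∈ 𝔇, (#(A.filter fun n => d ∣ n) : ℝ) := Finset.sum_le_sum hAd
    rw [Finset.sum_const, nsmul_eq_mul] at h1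
    have h2 : ∑ d ∈ 𝔇, (#(A.filter fun n => d ∣ n) : ℝ) = ∑ n ∈ A, g n := by
      simp only [hg]; exact_mod_cast sum_card_multiples_eq A 𝔇
    linarith
  -- `g` vanishes off `U`, so `S₁ = Σ_{n∈U} g(n)·1`
  have hS₁U : ∑ n ∈ A, g n = ∑ n ∈ U, g n * 1 := by
    rw [hU, Finset.sum_filter]
    refine Finset.sum_congr rfl fun n _ => ?_
    split_ifs with h
    · rw [mul_one]
    · simp only [hg]
      rw [Nat.cast_eq_zero, Finset.card_eq_zero, Finset.filter_eq_empty_iff]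
      exact fun d hd hdn => h ⟨d, hd, hdn⟩
  -- Cauchy–Schwarz: `S₁² ≤ (Σ_{U} g²) |U| ≤ (Σ_{A} τ²) |U|`
  have hCS : (∑ n ∈ A, g n) ^ 2 ≤ (#U : ℝ) * ∑ n ∈ A, τ n ^ 2 := by
    rw [hS₁U]
    refine (sum_mul_sq_le_sq_mul_sq U g fun _ => (1 : ℝ)).trans ?_
    simp only [one_pow, sum_const, nsmul_eq_mul, mul_one]
    rw [mul_comm]
    refine mul_le_mul_of_nonneg_left ?_ (Nat.cast_nonneg _)
    calc ∑ n ∈ U, g n ^ 2 ≤ ∑ n ∈ A, g n ^ 2 :=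
          Finset.sum_le_sum_of_subset_of_nonneg (Finset.filter_subset _ _) fun n _ _ => sq_nonneg _
      _ ≤ ∑ n ∈ A, τ n ^ 2 := Finset.sum_le_sum fun n hn => by
          have h := card_filter_dvd_le_card_divisors 𝔇 (n := n) (by have := (hN1 n hn).1; omega)
          have h' : g n ≤ τ n := by simp only [hg, hτ]; exact_mod_cast h
          exact pow_le_pow_left₀ (by simp only [hg]; positivity) h' 2
  -- Jensen: `(Σ_A τ²)^r ≤ |A|^{r-1} Σ_A τ^{2r} ≤ |A|^{r-1} N (1+log N)^{4^r}`
  have hJ : (∑ n ∈ A, τ n ^ 2) ^ r ≤ (#A : ℝ) ^ (r - 1) * (N * (1 + Real.log N) ^ (4 ^ r)) := by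
    obtain ⟨r', rfl⟩ : ∃ r', r = r' + 1 := ⟨r - 1, by omega⟩
    rw [Nat.add_sub_cancel]
    have hmom : ∑ n ∈ A, (τ n ^ 2) ^ (r' + 1) ≤ N * (1 + Real.log N) ^ (4 ^ (r' + 1)) := by
      calc ∑ n ∈ A, (τ n ^ 2) ^ (r' + 1) = ∑ n ∈ A, τ n ^ (2 * (r' + 1)) :=
            Finset.sum_congr rfl fun n _ => by rw [← pow_mul]
        _ ≤ ∑ n ∈ Icc 1 N, τ n ^ (2 * (r' + 1)) :=
            Finset.sum_le_sum_of_subset_of_nonneg hA fun n _ _ => by simp only [hτ]; positivity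
        _ ≤ N * (1 + Real.log N) ^ (2 ^ (2 * (r' + 1))) := sum_card_divisors_pow_le _ N
        _ = N * (1 + Real.log N) ^ (4 ^ (r' + 1)) := by
            rw [pow_mul, show (2 : ℕ) ^ 2 = 4 by norm_num]
    rcases A.eq_empty_or_nonempty with hAe | hAne
    · rw [hAe]
      simp only [sum_empty, card_empty, Nat.cast_zero]
      rw [zero_pow (by omega)]
      rcases Nat.eq_zero_or_pos r' with h0 | h0
      · subst h0; simp only [pow_zero, one_mul]; positivity
      · rw [zero_pow (by omega), zero_mul]
    have hApos : (0 : ℝ) < #A := by exact_mod_cast hAne.card_pos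
    have hJ' := pow_sum_div_card_le_sum_pow (s := A) (f := fun n => τ n ^ 2)
      (fun n _ => sq_nonneg _) r'
    rw [div_le_iff₀ (by positivity)] at hJ'
    calc (∑ n ∈ A, τ n ^ 2) ^ (r' + 1) ≤ (∑ i ∈ A, (τ i ^ 2) ^ (r' + 1)) * (#A : ℝ) ^ r' := hJ'
      _ ≤ (N * (1 + Real.log N) ^ (4 ^ (r' + 1))) * (#A : ℝ) ^ r' :=
          mul_le_mul_of_nonneg_right hmom (by positivity)
      _ = _ := by ring
  -- assemble
  have hS₁nn : 0 ≤ δ * #𝔇 * #A := by positivity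
  calc (δ * #𝔇 * #A) ^ (2 * r) = ((δ * #𝔇 * #A) ^ 2) ^ r := by rw [pow_mul]
    _ ≤ ((∑ n ∈ A, g n) ^ 2) ^ r :=
        pow_le_pow_left₀ (sq_nonneg _) (pow_le_pow_left₀ hS₁nn hS₁ 2) r
    _ ≤ ((#U : ℝ) * ∑ n ∈ A, τ n ^ 2) ^ r := pow_le_pow_left₀ (sq_nonneg _) hCS r
    _ = (#U : ℝ) ^ r * (∑ n ∈ A, τ n ^ 2) ^ r := mul_pow _ _ _
    _ ≤ (#U : ℝ) ^ r * ((#A : ℝ) ^ (r - 1) * (N * (1 + Real.log N) ^ (4 ^ r))) :=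
        mul_le_mul_of_nonneg_left hJ (by positivity)
    _ = _ := by ring

/-- **Lemma 49 (divisor packing lemma, GT 2008b App. B)**, printed shape with `κ = 1/r`: under the
hypotheses of `divisor_packing_pow`,
`|⋃_{d∈𝔇} A_d| ≥ δ²|𝔇|²|A| · (|A| / (N(1+log N)^{4^r}))^{1/r}`.
[cite: GreenTao2008QuadraticMobius, App. B, Lemma 49] -/
theorem divisor_packing (N : ℕ) (A : Finset ℕ) (hA : A ⊆ Icc 1 N) (𝔇 : Finset ℕ) {δ : ℝ}
    (hδ : 0 ≤ δ) (hAd : ∀ d ∈ 𝔇, δ * #A ≤ #(A.filter fun n => d ∣ n)) {r : ℕ} (hr : 1 ≤ r) :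
    δ ^ 2 * (#𝔇 : ℝ) ^ 2 * #A *
        ((#A : ℝ) / (N * (1 + Real.log N) ^ (4 ^ r))) ^ ((1 : ℝ) / r) ≤
      #(A.filter fun n => ∃ d ∈ 𝔇, d ∣ n) := by
  classical
  have hcore := divisor_packing_pow N A hA 𝔇 hδ hAd hr
  set U : ℝ := (#(A.filter fun n => ∃ d ∈ 𝔇, d ∣ n) : ℝ) with hU
  have hU0 : 0 ≤ U := Nat.cast_nonneg _
  have hrpos : (0 : ℝ) < r := by exact_mod_cast hr
  have hlog : 0 ≤ 1 + Real.log N := by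
    rcases Nat.eq_zero_or_pos N with h | h
    · simp [h]
    · have : (1 : ℝ) ≤ N := by exact_mod_cast h
      linarith [Real.log_nonneg this]
  set M : ℝ := N * (1 + Real.log N) ^ (4 ^ r) with hM
  have hM0 : 0 ≤ M := by positivity
  -- degenerate cases `A = ∅` or `M = 0`
  rcases A.eq_empty_or_nonempty with hAe | hAne
  · have : (#A : ℝ) = 0 := by rw [hAe]; simp
    rw [this, mul_zero, zero_mul]
    exact hU0
  have hApos : (0 : ℝ) < #A := by exact_mod_cast hAne.card_pos
  rcases hM0.eq_or_lt with hM00 | hMpos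
  · rw [← hM00, div_zero, Real.zero_rpow (by positivity), mul_zero]; exact hU0
  -- `(δ|𝔇||A|)^{2r} ≤ U^r |A|^{r-1} M` ⇒ `(δ|𝔇|)² |A| (|A|/M)^{1/r} ≤ U`
  have hX0 : 0 ≤ (#A : ℝ) / M := by positivity
  -- compare `r`-th powers
  have hUr : (δ ^ 2 * (#𝔇 : ℝ) ^ 2 * #A * ((#A : ℝ) / M) ^ ((1 : ℝ) / r)) ^ r ≤ U ^ r := by
    rw [mul_pow, ← Real.rpow_mul_natCast hX0, one_div_mul_cancel hrpos.ne', Real.rpow_one]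
    -- `(δ²|𝔇|²|A|)^r (|A|/M) ≤ U^r` from the core inequality
    rw [mul_div_assoc', div_le_iff₀ hMpos]
    have e : (δ ^ 2 * (#𝔇 : ℝ) ^ 2 * #A) ^ r * #A =
        (δ * #𝔇 * #A) ^ (2 * r) / (#A : ℝ) ^ (r - 1) := by
      obtain ⟨r', rfl⟩ : ∃ r', r = r' + 1 := ⟨r - 1, by omega⟩
      rw [Nat.add_sub_cancel, eq_div_iff (by positivity)]
      ring
    rw [e, div_le_iff₀ (by positivity)]
    calc (δ * #𝔇 * #A) ^ (2 * r) ≤ U ^ r * (#A : ℝ) ^ (r - 1) * M := hcore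
      _ = U ^ r * M * (#A : ℝ) ^ (r - 1) := by ring
  have hL0 : 0 ≤ δ ^ 2 * (#𝔇 : ℝ) ^ 2 * #A * ((#A : ℝ) / M) ^ ((1 : ℝ) / r) := by positivity
  exact (pow_le_pow_iff_left₀ hL0 hU0 (by omega)).1 hUr

end Summit.Parity.GeneralizedHardyLittlewood.GreenTaoLevelTwoMNTwoDivisorPacking
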